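import Mathlib
import HarnessLib
import Summits.HubbardSuperconductivity.HubbardSuperconductivity.Theorems.KLProgrammePerturbedFermiCurveTwoFrameRegime

/-!
# Route `KLProgramme` — the radius tower and the curve sizes of an ARBITRARY `C²`-small frame (not necessarily `FrameOK`), keyed by its
# sizes `A ≤ 1/20`, `A₃`, `A₄` at a level `ν` with window margins — the single-frame inputs of the (E3a-MS) chain frames

Cell `gate-hubbard-kl`, seat hubbard-kl-k3c3-p3 (g3; row «implicit-function / monotonicity route»).  The frames of the (E3a-MS) recipe (L)+(F)
(k3c3-p1 MS-DESIGN-NOTE §3; gen-5 ENGINE child stmt-HubbardSuperconductivity-19918, `stub_twoLeg_step`) are level-shifted, frequency-split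
partial sums of an admissible frame's pieces — NOT themselves `FrameOK`.  `…PerturbedFermiCurveTower` (p486548) keyed the explicit radius
tower (`klCurveR1`, `klCurveR2`, `klCurveT3 A₃`, `klCurveT4 A₃ A₄`) and the curve sizes (`klCurveD1 … D4`) by `FrameOK` in the KL regime; this
module states the SAME conclusions for any `K : TrigPolyC4v` with `‖Dʲ frameShift K‖ ≤ A` (`j ≤ 2`), `A ≤ 1/20`, `klCurveD ≤ Dt_min − 2A`
(`Dt_min = cDtmin (−1.1) (−0.1)`), margins `−1.1 ≤ ν − A`, `ν + A ≤ −0.1`, and order-3/4 sizes `A₃, A₄`: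
`frameRadius_tower_of_sizes`, `fermiPointLp_sizes_of_sizes` — the `R`'s and `D`'s the two-frame packaging `…TwoFrameRegime` (p493044) consumes.

Everything is PROVED; no definitions; nothing about the Hubbard model.  References: BGM 2006 §2.4 Lemma 2.1 (2.40)
[cite: BenfattoGiulianiMastropietro2006].
-/

noncomputable section

namespace Summit.HubbardSuperconductivity.HubbardSuperconductivity.Theorems.PerturbedFermiCurve

set_option linter.dupNamespace false -- summit = problem name (single-conjunct summit), D-0017

open Real Set
open Literature.MathematicalPhysics.QuantumLattice Literature.MathematicalPhysics.QuantumLattice.BandSectorCounting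
open Summit.HubbardSuperconductivity.HubbardSuperconductivity.Theorems.DispersionFlow
open Summit.HubbardSuperconductivity.HubbardSuperconductivity.Theorems.KLRegimeSplit

section Sizes

variable {K : TrigPolyC4v} {A : ℝ} (hA : ∀ p : Momentum, ∀ j ≤ 2, ‖iteratedFDeriv ℝ j (frameShift K) p‖ ≤ A) (hA20 : A ≤ 1 / 20)
  (hd : klCurveD ≤ (bandBounds (show (-4 : ℝ) < -1.1 by norm_num) (show (-1.1 : ℝ) ≤ -0.1 by norm_num)
    (show (-0.1 : ℝ) < 0 by norm_num)).Dtmin - 2 * A)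
  {ν : ℝ} (hlo : (-1.1 : ℝ) ≤ ν - A) (hhi : ν + A ≤ -0.1)
  {A₃ A₄ : ℝ} (hA₃ : ∀ p : Momentum, ‖iteratedFDeriv ℝ 3 (frameShift K) p‖ ≤ A₃)
  (hA₄ : ∀ p : Momentum, ‖iteratedFDeriv ℝ 4 (frameShift K) p‖ ≤ A₄)
include hA hA20 hd hlo hhi hA₃ hA₄

/-- **The radius tower of a `C²`-small frame, keyed by its sizes**: `|u| ≤ π√2`, `|u′| ≤ klCurveR1`, `|u″| ≤ klCurveR2`, `|u‴| ≤ klCurveT3 A₃`,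
`|u⁗| ≤ klCurveT4 A₃ A₄` at every angle, `u = perturbedFermiRadius (−K.eval) ν`. [cite: BenfattoGiulianiMastropietro2006, §2.4 Lemma 2.1 (2.40)] -/
theorem frameRadius_tower_of_sizes (θ : ℝ) :
    |perturbedFermiRadius (fun p : Fin 2 → ℝ => -K.eval p) ν θ| ≤ π * Real.sqrt 2 ∧
    |deriv (perturbedFermiRadius (fun p : Fin 2 → ℝ => -K.eval p) ν) θ| ≤ klCurveR1 ∧
    |deriv (deriv (perturbedFermiRadius (fun p : Fin 2 → ℝ => -K.eval p) ν)) θ| ≤ klCurveR2 ∧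
    |deriv (deriv (deriv (perturbedFermiRadius (fun p : Fin 2 → ℝ => -K.eval p) ν))) θ| ≤ klCurveT3 A₃ ∧
    |deriv (deriv (deriv (deriv (perturbedFermiRadius (fun p : Fin 2 → ℝ => -K.eval p) ν)))) θ| ≤ klCurveT4 A₃ A₄ := by
  set B := bandBounds (show (-4 : ℝ) < -1.1 by norm_num) (show (-1.1 : ℝ) ≤ -0.1 by norm_num) (show (-0.1 : ℝ) < 0 by norm_num)
    with hBdef
  set d := klCurveD with hdd
  have hdpos : 0 < d := klCurveD_pos
  have hADt : 2 * A < B.Dtmin := by linarith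
  set s := π * Real.sqrt 2 with hs
  have hs0 : 0 < s := by positivity
  have hr₁0 : 0 ≤ klCurveR1 := klCurveR1_nonneg
  have hr₂0 : 0 ≤ klCurveR2 := klCurveR2_nonneg
  have hA₃0 : 0 ≤ A₃ := (norm_nonneg _).trans (hA₃ 0)
  have hA₄0 : 0 ≤ A₄ := (norm_nonneg _).trans (hA₄ 0)
  have hr₃0 : 0 ≤ klCurveT3 A₃ := klCurveT3_nonneg hA₃0
  have hR₀ : |perturbedFermiRadius (fun p : Fin 2 → ℝ => -K.eval p) ν θ| ≤ s := by
    rw [abs_of_pos (frameRadius_pos B hA hlo hhi θ)]; exact frameRadius_le B hA hlo hhi θ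
  have hR₁ : |deriv (perturbedFermiRadius (fun p : Fin 2 → ℝ => -K.eval p) ν) θ| ≤ klCurveR1 := by
    refine (abs_deriv_frameRadius_le_uniform B hA hADt hlo hhi θ).trans ?_
    unfold klCurveR1; rw [← hdd]
    exact div_relax (mul_le_mul_of_nonneg_right (by linarith only [hA20]) hs0.le) (by positivity) hdpos hd
  have hR₂ : |deriv (deriv (perturbedFermiRadius (fun p : Fin 2 → ℝ => -K.eval p) ν)) θ| ≤ klCurveR2 := by
    refine (abs_deriv_two_frameRadius_le B hA hADt hlo hhi hR₁).trans ?_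
    unfold klCurveR2; rw [← hdd]
    have hK : 0 ≤ (klCurveR1 + s) ^ 2 := sq_nonneg _
    have hL : 0 ≤ 2 * klCurveR1 + s := by positivity
    exact div_relax (add_le_add (mul_le_mul_of_nonneg_right (by linarith only [hA20]) hK)
      (mul_le_mul_of_nonneg_right (by linarith only [hA20]) hL)) (by positivity) hdpos hd
  have hR₃ : |deriv (deriv (deriv (perturbedFermiRadius (fun p : Fin 2 → ℝ => -K.eval p) ν))) θ| ≤ klCurveT3 A₃ := by
    refine (abs_deriv_three_frameRadius_le B hA hADt hlo hhi hA₃ hR₁ hR₂).trans ?_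
    have hnum := num_three_le (G := A₃) (P := 1) hA20 (by rw [mul_one]) le_rfl hr₁0 hr₂0 hs0.le
    rw [mul_one] at hnum
    refine (div_relax hnum (by positivity) hdpos hd).trans (le_of_eq ?_)
    unfold klCurveT3; rw [← hdd]
  have hR₄ : |deriv (deriv (deriv (deriv (perturbedFermiRadius (fun p : Fin 2 → ℝ => -K.eval p) ν)))) θ| ≤ klCurveT4 A₃ A₄ := by
    refine (abs_deriv_four_frameRadius_le B hA hADt hlo hhi hA₃ hA₄ hR₁ hR₂ hR₃).trans ?_
    have hnum := num_four_le (G₃ := A₃) (G₄ := A₄) (P := 1) (Q := 1) (r₃ := klCurveT3 A₃) hA20 (by rw [mul_one]) (by rw [mul_one])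
      hA₃0 le_rfl le_rfl hr₁0 hr₂0 hr₃0 hs0.le
    simp only [mul_one] at hnum
    refine (div_relax hnum (by positivity) hdpos hd).trans (le_of_eq ?_)
    unfold klCurveT4; rw [← hdd]
  exact ⟨hR₀, hR₁, hR₂, hR₃, hR₄⟩

/-- **The curve sizes of a `C²`-small frame, keyed by its sizes**: `γ_K = toLp ∘ klFermiPoint ν K` is `C⁴` and
`‖D¹γ_K‖ ≤ klCurveD1`, `‖D²γ_K‖ ≤ klCurveD2`, `‖D³γ_K‖ ≤ klCurveD3 A₃`, `‖D⁴γ_K‖ ≤ klCurveD4 A₃ A₄` at every angle. -/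
theorem fermiPointLp_sizes_of_sizes (θ : ℝ) :
    ContDiff ℝ 4 (fun θ : ℝ => (WithLp.toLp 2 (klFermiPoint ν K θ) : Momentum)) ∧
    ‖iteratedFDeriv ℝ 1 (fun θ : ℝ => (WithLp.toLp 2 (klFermiPoint ν K θ) : Momentum)) θ‖ ≤ klCurveD1 ∧
    ‖iteratedFDeriv ℝ 2 (fun θ : ℝ => (WithLp.toLp 2 (klFermiPoint ν K θ) : Momentum)) θ‖ ≤ klCurveD2 ∧
    ‖iteratedFDeriv ℝ 3 (fun θ : ℝ => (WithLp.toLp 2 (klFermiPoint ν K θ) : Momentum)) θ‖ ≤ klCurveD3 A₃ ∧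
    ‖iteratedFDeriv ℝ 4 (fun θ : ℝ => (WithLp.toLp 2 (klFermiPoint ν K θ) : Momentum)) θ‖ ≤ klCurveD4 A₃ A₄ := by
  set B := bandBounds (show (-4 : ℝ) < -1.1 by norm_num) (show (-1.1 : ℝ) ≤ -0.1 by norm_num) (show (-0.1 : ℝ) < 0 by norm_num)
    with hBdef
  have hADt : 2 * A < B.Dtmin := by have := klCurveD_pos; linarith
  obtain ⟨h0, h1, h2, h3, h4⟩ := frameRadius_tower_of_sizes hA hA20 hd hlo hhi hA₃ hA₄ θ
  obtain ⟨g1, g2, g3, g4⟩ := norm_iteratedFDeriv_fermiPointLp_le_four_orders B hA hADt hlo hhi h0 h1 h2 h3 h4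
  refine ⟨contDiff_four_fermiPointLp B hA hADt hlo hhi, g1.trans (le_of_eq ?_), g2.trans (le_of_eq ?_), g3.trans (le_of_eq ?_),
    g4.trans (le_of_eq ?_)⟩
  · unfold klCurveD1; ring
  · unfold klCurveD2; ring
  · unfold klCurveD3; ring
  · unfold klCurveD4; ring

end Sizes

end Summit.HubbardSuperconductivity.HubbardSuperconductivity.Theorems.PerturbedFermiCurve

end
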